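import Mathlib.RingTheory.MvPolynomial.Basic
import Mathlib.Algebra.MvPolynomial.Degrees
import Mathlib.Algebra.MvPolynomial.CommRing
import Mathlib.Algebra.BigOperators.Group.Finset.Basic
import HarnessLib

/-!
# Nullstellensatz refutations and their degree

Definitions (real, with bodies; NO named facts in this file) of the algebraic proof-complexity
vocabulary used by routes MatrixMultiplication/BrentRefutationDepth and
ValiantsHypothesis/RefutationDegree, after Krajíček, *Proof Complexity* (CUP 2019), §6.2 (the
Nullstellensatz proof system NS) and §16.1–16.2 (degree of NS/PC proofs):

* `HasNSRefutationOfDegree 𝒜 d` — a family `𝒜 : ι → K[σ]` of polynomial axioms (the system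
  `{𝒜 a = 0}`) has a **Nullstellensatz refutation of degree `≤ d`**: finitely many multipliers
  `g a` with `∑ g a · 𝒜 a = 1` and every PRODUCT `g a · 𝒜 a` of total degree `≤ d` (Krajíček's
  degree of an NS-proof, §6.2; this is the convention of Thm 16.2.1 / Lemma 16.2.3).
* `HasNSRefutationWithMultipliersOfDegree 𝒜 D` — the same with the bound on the MULTIPLIERS
  `g a` (the convention inlined by route BrentRefutationDepth, e.g. item `NSDepthLowerBound`);
  `hasNSRefutationOfDegree_of_multipliers` converts (`D + e`, `e` a bound on the axiom degrees) and
  `hasNSRefutationWithMultipliersOfDegree_iff_forall` is the `Fintype`-indexed "`∃ g, (∀ a, deg g a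
  ≤ D) ∧ ∑_a g a 𝒜 a = 1`" form the routes write.
The polynomial calculus PC/F itself (bounded-degree derivability `PC.DerivableInDegree`,
`PC.RefutableInDegree`), the system `¬WPHP^m_n` (`PC.negWPHP F m n`, Krajíček §16.2 p. 333) and
Razborov's degree lower bound (named fact `PC.Razborov1998_PC_negWPHP_degree`, Thm. 16.2.1) are
ALREADY in the tree: `Literature/Computability/MetaComplexity/PolynomialCalculus.lean`. This file
adds only the NS notions (which that file deliberately excludes) and is kept Mathlib-only so that
routes needing just the NS vocabulary (BrentRefutationDepth, D1) import no named fact; the bridge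
"an NS refutation of degree `≤ d` is a degree-`≤ d` PC refutation" and the NS form of Razborov's
bound as a THEOREM live in `NullstellensatzPC.lean`. Coefficients: any commutative ring `K` for the
definitions (Krajíček works over a field; the degree bounds are stated for fields only).

Mathlib: `MvPolynomial`, `totalDegree` (`totalDegree_mul`); Mathlib has no proof-complexity
vocabulary.

## References

* J. Krajíček, *Proof Complexity*, Encyclopedia Math. Appl. 170, CUP 2019: §6.2 (NS, PC and their
  degree), §16.1–16.2 (degree of NS/PC proofs). [KrajicekProofComplexity2019]
-/

noncomputable section

open MvPolynomial Finset

namespace Literature.Computability.Complexity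

/-! ### Nullstellensatz refutations -/

section NS

variable {ι σ K : Type*} [CommRing K]

/-- **Nullstellensatz refutation of degree `≤ d`** of the polynomial system `{𝒜 a = 0}_a`
(Krajíček 2019, §6.2): finitely many multipliers `g a` with `∑_a g a · 𝒜 a = 1` such that every
product `g a · 𝒜 a` has total degree `≤ d`. [cite: KrajicekProofComplexity2019, §6.2] -/
def HasNSRefutationOfDegree (𝒜 : ι → MvPolynomial σ K) (d : ℕ) : Prop :=
  ∃ (s : Finset ι) (g : ι → MvPolynomial σ K),
    (∑ a ∈ s, g a * 𝒜 a) = 1 ∧ ∀ a ∈ s, (g a * 𝒜 a).totalDegree ≤ d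

/-- **Nullstellensatz refutation with multipliers of degree `≤ D`**: as above but bounding the
total degree of the multipliers `g a` (the convention of route MatrixMultiplication/
BrentRefutationDepth). [cite: KrajicekProofComplexity2019, §6.2] -/
def HasNSRefutationWithMultipliersOfDegree (𝒜 : ι → MvPolynomial σ K) (D : ℕ) : Prop :=
  ∃ (s : Finset ι) (g : ι → MvPolynomial σ K),
    (∑ a ∈ s, g a * 𝒜 a) = 1 ∧ ∀ a ∈ s, (g a).totalDegree ≤ D

/-- Degree bounds are monotone. [folklore] -/
theorem HasNSRefutationOfDegree.mono {𝒜 : ι → MvPolynomial σ K} {d d' : ℕ}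
    (h : HasNSRefutationOfDegree 𝒜 d) (hd : d ≤ d') : HasNSRefutationOfDegree 𝒜 d' := by
  obtain ⟨s, g, hsum, hdeg⟩ := h
  exact ⟨s, g, hsum, fun a ha => (hdeg a ha).trans hd⟩

/-- Multiplier bounds are monotone. [folklore] -/
theorem HasNSRefutationWithMultipliersOfDegree.mono {𝒜 : ι → MvPolynomial σ K} {D D' : ℕ}
    (h : HasNSRefutationWithMultipliersOfDegree 𝒜 D) (hD : D ≤ D') :
    HasNSRefutationWithMultipliersOfDegree 𝒜 D' := by
  obtain ⟨s, g, hsum, hdeg⟩ := h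
  exact ⟨s, g, hsum, fun a ha => (hdeg a ha).trans hD⟩

/-- Multipliers of degree `≤ D` against axioms of degree `≤ e` give products of degree `≤ D + e`
(`totalDegree_mul`). [folklore] -/
theorem hasNSRefutationOfDegree_of_multipliers {𝒜 : ι → MvPolynomial σ K} {D e : ℕ}
    (h : HasNSRefutationWithMultipliersOfDegree 𝒜 D) (he : ∀ a, (𝒜 a).totalDegree ≤ e) :
    HasNSRefutationOfDegree 𝒜 (D + e) := by
  obtain ⟨s, g, hsum, hdeg⟩ := h
  refine ⟨s, g, hsum, fun a ha => (totalDegree_mul (g a) (𝒜 a)).trans ?_⟩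
  exact Nat.add_le_add (hdeg a ha) (he a)

/-- For a finitely indexed system, the multiplier form is the "`∃ g, (∀ a, deg (g a) ≤ D) ∧
∑_a g a · 𝒜 a = 1`" inlined by the routes (extend the multipliers by `0`). [folklore] -/
theorem hasNSRefutationWithMultipliersOfDegree_iff_forall [Fintype ι]
    (𝒜 : ι → MvPolynomial σ K) (D : ℕ) :
    HasNSRefutationWithMultipliersOfDegree 𝒜 D ↔
      ∃ g : ι → MvPolynomial σ K, (∀ a, (g a).totalDegree ≤ D) ∧ (∑ a, g a * 𝒜 a) = 1 := by
  classical
  constructor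
  · rintro ⟨s, g, hsum, hdeg⟩
    refine ⟨fun a => if a ∈ s then g a else 0, fun a => ?_, ?_⟩
    · by_cases ha : a ∈ s
      · simp [ha, hdeg a ha]
      · simp [ha]
    · rw [← hsum, ← Finset.sum_subset (Finset.subset_univ s)]
      · exact Finset.sum_congr rfl fun a ha => by simp [ha]
      · intro a _ ha
        simp [ha]
  · rintro ⟨g, hdeg, hsum⟩
    exact ⟨Finset.univ, g, hsum, fun a _ => hdeg a⟩

end NS

end Literature.Computability.Complexity
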